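import Mathlib.NumberTheory.Chebyshev
import Mathlib.Analysis.SpecialFunctions.Pow.Real
import Mathlib.Analysis.Convex.SpecificFunctions.Basic
import Mathlib.Analysis.Complex.ExponentialBounds
import HarnessLib

/-!
# From `ψ` to `π` in short intervals: the partial-summation transfer

NOT RH-BEARING. A density theorem counts zeros off the critical line, it never empties the strip
(`Literature.Barriers.RiemannHypothesis.LindelofBacklund`); the lemmas below are about primes in short
intervals and are RH-FREE, elementary, and proved from Mathlib's Chebyshev file alone. Nothing here
bears on the truth of RH.

Topic `Literature/NumberTheory/LFunctions`; namespace `Literature.NumberTheory.LFunctions.PrimeWindow`.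
Pure-proof file (theorems only; no definition, no named fact).

This is the step "By partial summation, it suffices to prove corresponding results for the
Von Mangoldt function in place of the prime indicator function" of Guth–Maynard, §13.2 (proof of
Cor. 1.3/1.4), written POINTWISE with explicit constants so that both the all-`x` corollary
(Cor. 1.3, `y ≥ x^{17/30+ε}`) and the almost-all corollary (Cor. 1.4, `y ≥ X^{2/15+ε}`, where
`y < √x` is allowed) can use it. With `π(u) := Nat.primeCounting ⌊u⌋₊`, `θ, ψ` Mathlib's Chebyshev
functions and the window `x < p ≤ x + y`:

* `theta_window_eq_sum`, `primeCounting_window_eq_card` — `θ(x+y) − θ(x) = ∑_{x<p≤x+y} log p`,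
  `π(x+y) − π(x) = #{x < p ≤ x+y}`;
* `card_mul_log_le_theta_window`, `theta_window_le_card_mul_log` — the sandwich
  `(π(x+y) − π(x)) log x ≤ θ(x+y) − θ(x) ≤ (π(x+y) − π(x)) log(x+y)`;
* `abs_primeCounting_window_sub_le` — **the transfer**: for `x > 1`, `y ≥ 0`,
  `|π(x+y) − π(x) − y/log x| ≤ |θ(x+y) − θ(x) − y|/log x + y²/(x log² x)`;
* `psi_sub_theta_window_le_sqrt` (crude) and `psi_sub_theta_window_le` (sharp) — the proper prime
  powers in the window: `0 ≤ (ψ−θ)(x+y) − (ψ−θ)(x) ≤ 2√(x+y) log(x+y)`, and, counting `k`-th powers in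
  `(x, x+y]` (at most `y/(2√x) + 1` of them for each `2 ≤ k ≤ log₂(x+y)`),
  `≤ (y/(2√x) + 1) log²(x+y)` — the form needed when `y < √x`;
* `abs_primeCounting_window_sub_le_of_psi`, `abs_primeCounting_window_sub_le_of_psi_sharp` and the
  `E`-forms `…_of_abs_psi_le` — `|ψ(x+y) − ψ(x) − y| ≤ E ⇒ |π(x+y) − π(x) − y/log x| ≤ E/log x + …`;
* `exists_rpow_le_mul`, `exists_exp_log_rpow_le_rpow` — growth bookkeeping for error terms
  `exp(−(log x)^κ)`, `κ < 1`: eventually `(log x)^κ ≤ a log x`, i.e. `exp((log x)^κ) ≤ x^a`.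

Design: everything is stated for real `x, y` (natural `x` is the special case `⌊(x:ℝ)⌋₊ = x`,
`Nat.floor_natCast`). The increment lemmas `Halasz.psi_sub_psi_eq`, `Halasz.psi_sub_theta_mono`,
`Halasz.theta_sub_theta_le` of `HalaszRestrictedShortMeanSquare.lean` (tree) are the same circle of
ideas for multiplicative windows `(y, νy]`; they are not imported here to keep this file's import cone
at Mathlib's Chebyshev file (the two needed one-liners are re-derived from the sandwich).

## References

* L. Guth, J. Maynard, *New large value estimates for Dirichlet polynomials*, Ann. of Math. (2) 203
  (2026) 623–675 = arXiv:2405.20552, §13.2 (first paragraph: "By partial summation …").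
  [GuthMaynard2026]
* H. L. Montgomery, R. C. Vaughan, *Multiplicative Number Theory I. Classical Theory*, CUP 2007, §2.2
  Cor. 2.5 and its proof (`ϑ(x) = ψ(x) + O(x^{1/2})` via `ψ(x) − ϑ(x) = ∑_{k≥2} ϑ(x^{1/k})`;
  `π(x) = ψ(x)/log x + O(x/log² x)` by partial summation) — the classical template of the transfer.
  [MontgomeryVaughan2007]
* Mathlib `Mathlib.NumberTheory.Chebyshev` (`Chebyshev.theta_le_psi`, `Chebyshev.psi_sub_theta_le`,
  `Chebyshev.psi_eq_theta_add_sum_theta'`, `Chebyshev.theta_eq_sum_primesLE`,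
  `Nat.primesLE_card_eq_primeCounting`). [folklore]
-/

noncomputable section

open Finset Real
open scoped Chebyshev Nat.Prime

namespace Literature.NumberTheory.LFunctions

namespace PrimeWindow

/-! ### The window `x < p ≤ x + y` -/

/-- For `y ≥ 0` the primes `≤ ⌊x⌋₊` are among the primes `≤ ⌊x + y⌋₊`. [cite: GuthMaynard2026, §13.2 (proof of Cor. 1.3–1.4, partial-summation step)] -/
private theorem primesLE_floor_subset {x y : ℝ} (hy : 0 ≤ y) :
    Nat.primesLE ⌊x⌋₊ ⊆ Nat.primesLE ⌊x + y⌋₊ := by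
  intro p hp
  rw [Nat.mem_primesLE] at hp ⊢
  exact ⟨hp.1.trans (Nat.floor_le_floor (by linarith)), hp.2⟩

/-- A member of the window set `primesLE ⌊x+y⌋₊ \ primesLE ⌊x⌋₊` is a prime `p` with
`x < p ≤ x + y`. [cite: GuthMaynard2026, §13.2 (proof of Cor. 1.3–1.4, partial-summation step)] -/
private theorem mem_window {x y : ℝ} (hx : 0 ≤ x) (hy : 0 ≤ y) {p : ℕ}
    (hp : p ∈ Nat.primesLE ⌊x + y⌋₊ \ Nat.primesLE ⌊x⌋₊) :
    p.Prime ∧ x < p ∧ (p : ℝ) ≤ x + y := by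
  rw [Finset.mem_sdiff, Nat.mem_primesLE, Nat.mem_primesLE] at hp
  obtain ⟨⟨hple, hprime⟩, hnot⟩ := hp
  refine ⟨hprime, ?_, ?_⟩
  · by_contra h
    exact hnot ⟨Nat.le_floor (not_lt.mp h), hprime⟩
  · exact (Nat.cast_le.mpr hple).trans (Nat.floor_le (by positivity))

/-- The window set lies in `(⌊x⌋₊, ⌊x+y⌋₊]`. [cite: GuthMaynard2026, §13.2 (proof of Cor. 1.3–1.4, partial-summation step)] -/
private theorem window_subset_Ioc (x y : ℝ) :
    Nat.primesLE ⌊x + y⌋₊ \ Nat.primesLE ⌊x⌋₊ ⊆ Finset.Ioc ⌊x⌋₊ ⌊x + y⌋₊ := by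
  intro p hp
  rw [Finset.mem_sdiff, Nat.mem_primesLE, Nat.mem_primesLE] at hp
  rw [Finset.mem_Ioc]
  obtain ⟨⟨hple, hprime⟩, hnot⟩ := hp
  exact ⟨not_le.mp fun h => hnot ⟨h, hprime⟩, hple⟩

/-- `θ(x+y) − θ(x) = ∑_{x < p ≤ x+y} log p` (`y ≥ 0`). [cite: GuthMaynard2026, §13.2 (proof of Cor. 1.3–1.4, partial-summation step)] -/
theorem theta_window_eq_sum {x y : ℝ} (hy : 0 ≤ y) :
    θ (x + y) - θ x = ∑ p ∈ Nat.primesLE ⌊x + y⌋₊ \ Nat.primesLE ⌊x⌋₊, Real.log p := by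
  rw [Chebyshev.theta_eq_sum_primesLE, Chebyshev.theta_eq_sum_primesLE,
    ← Finset.sum_sdiff (primesLE_floor_subset hy), add_sub_cancel_right]

/-- `π(x+y) − π(x) = #{p prime : x < p ≤ x+y}` (`y ≥ 0`). [cite: GuthMaynard2026, §13.2 (proof of Cor. 1.3–1.4, partial-summation step)] -/
theorem primeCounting_window_eq_card {x y : ℝ} (hy : 0 ≤ y) :
    (π ⌊x + y⌋₊ : ℝ) - π ⌊x⌋₊ = ((Nat.primesLE ⌊x + y⌋₊ \ Nat.primesLE ⌊x⌋₊).card : ℝ) := by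
  rw [Finset.card_sdiff_of_subset (primesLE_floor_subset hy),
    Nat.cast_sub (Finset.card_le_card (primesLE_floor_subset hy)),
    Nat.primesLE_card_eq_primeCounting, Nat.primesLE_card_eq_primeCounting]

/-- `0 ≤ π(x+y) − π(x)` (`y ≥ 0`). [cite: GuthMaynard2026, §13.2 (proof of Cor. 1.3–1.4, partial-summation step)] -/
theorem primeCounting_window_nonneg {x y : ℝ} (hy : 0 ≤ y) :
    0 ≤ (π ⌊x + y⌋₊ : ℝ) - π ⌊x⌋₊ := by
  rw [primeCounting_window_eq_card hy]
  exact Nat.cast_nonneg _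

/-- The trivial count `π(x+y) − π(x) ≤ ⌊x+y⌋₊ − ⌊x⌋₊ ≤ y + 1` (`x, y ≥ 0`). [cite: GuthMaynard2026, §13.2 (proof of Cor. 1.3–1.4, partial-summation step)] -/
theorem primeCounting_window_le {x y : ℝ} (hx : 0 ≤ x) (hy : 0 ≤ y) :
    (π ⌊x + y⌋₊ : ℝ) - π ⌊x⌋₊ ≤ y + 1 := by
  rw [primeCounting_window_eq_card hy]
  have h1 : ((Nat.primesLE ⌊x + y⌋₊ \ Nat.primesLE ⌊x⌋₊).card : ℝ)
      ≤ ((Finset.Ioc ⌊x⌋₊ ⌊x + y⌋₊).card : ℝ) := by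
    exact_mod_cast Finset.card_le_card (window_subset_Ioc x y)
  rw [Nat.card_Ioc] at h1
  have h2 : (⌊x + y⌋₊ : ℝ) ≤ x + y := Nat.floor_le (by positivity)
  have h3 : x < (⌊x⌋₊ : ℝ) + 1 := Nat.lt_floor_add_one x
  have h4 : ((⌊x + y⌋₊ - ⌊x⌋₊ : ℕ) : ℝ) = (⌊x + y⌋₊ : ℝ) - ⌊x⌋₊ := by
    rw [Nat.cast_sub (Nat.floor_le_floor (by linarith))]
  linarith

/-! ### The sandwich `log x ≤ log p ≤ log(x+y)` -/

/-- Lower sandwich: `(π(x+y) − π(x)) log x ≤ θ(x+y) − θ(x)` (each prime in the window exceeds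
`x > 0`). [cite: GuthMaynard2026, §13.2 (proof of Cor. 1.3–1.4, partial-summation step)] -/
theorem card_mul_log_le_theta_window {x y : ℝ} (hx : 0 < x) (hy : 0 ≤ y) :
    ((π ⌊x + y⌋₊ : ℝ) - π ⌊x⌋₊) * Real.log x ≤ θ (x + y) - θ x := by
  rw [primeCounting_window_eq_card hy, theta_window_eq_sum hy, Finset.card_eq_sum_ones,
    Nat.cast_sum, Finset.sum_mul]
  refine Finset.sum_le_sum fun p hp => ?_
  obtain ⟨-, hxp, -⟩ := mem_window hx.le hy hp
  simp only [Nat.cast_one, one_mul]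
  exact Real.log_le_log hx hxp.le

/-- Upper sandwich: `θ(x+y) − θ(x) ≤ (π(x+y) − π(x)) log(x+y)`. [cite: GuthMaynard2026, §13.2 (proof of Cor. 1.3–1.4, partial-summation step)] -/
theorem theta_window_le_card_mul_log {x y : ℝ} (hx : 0 < x) (hy : 0 ≤ y) :
    θ (x + y) - θ x ≤ ((π ⌊x + y⌋₊ : ℝ) - π ⌊x⌋₊) * Real.log (x + y) := by
  rw [primeCounting_window_eq_card hy, theta_window_eq_sum hy, Finset.card_eq_sum_ones,
    Nat.cast_sum, Finset.sum_mul]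
  refine Finset.sum_le_sum fun p hp => ?_
  obtain ⟨hprime, -, hpxy⟩ := mem_window hx.le hy hp
  simp only [Nat.cast_one, one_mul]
  exact Real.log_le_log (by exact_mod_cast hprime.pos) hpxy

/-- The crude increment of `θ`: `θ(x+y) − θ(x) ≤ (y + 1) log(x+y)` for `x ≥ 1`, `y ≥ 0`
(cf. `Halasz.theta_sub_theta_le` in the tree, same bound over windows `(y, z]`). [cite: GuthMaynard2026, §13.2 (proof of Cor. 1.3–1.4, partial-summation step)] -/
theorem theta_window_le {x y : ℝ} (hx : 1 ≤ x) (hy : 0 ≤ y) :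
    θ (x + y) - θ x ≤ (y + 1) * Real.log (x + y) := by
  have hlog : 0 ≤ Real.log (x + y) := Real.log_nonneg (by linarith)
  calc θ (x + y) - θ x ≤ ((π ⌊x + y⌋₊ : ℝ) - π ⌊x⌋₊) * Real.log (x + y) :=
        theta_window_le_card_mul_log (by linarith) hy
    _ ≤ (y + 1) * Real.log (x + y) :=
        mul_le_mul_of_nonneg_right (primeCounting_window_le (by linarith) hy) hlog

/-! ### The transfer `θ → π` -/

/-- **The partial-summation step** of Guth–Maynard §13.2 in a sharp elementary form:
for `x > 1`, `y ≥ 0`,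
`|π(x+y) − π(x) − y/log x| ≤ |θ(x+y) − θ(x) − y|/log x + y²/(x log² x)`,
from the sandwich `log x ≤ log p ≤ log(x+y) ≤ log x + y/x` on the window.
[cite: GuthMaynard2026, §13.2 (proof of Cor. 1.3 and 1.4, "By partial summation")] -/
theorem abs_primeCounting_window_sub_le {x y : ℝ} (hx : 1 < x) (hy : 0 ≤ y) :
    |(π ⌊x + y⌋₊ : ℝ) - π ⌊x⌋₊ - y / Real.log x|
      ≤ |θ (x + y) - θ x - y| / Real.log x + y ^ 2 / (x * Real.log x ^ 2) := by
  set D : ℝ := (π ⌊x + y⌋₊ : ℝ) - π ⌊x⌋₊ with hD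
  set S : ℝ := θ (x + y) - θ x with hS
  have hx0 : 0 < x := by linarith
  have hL : 0 < Real.log x := Real.log_pos hx
  have hL' : Real.log x ≤ Real.log (x + y) := Real.log_le_log hx0 (by linarith)
  have hL'0 : 0 < Real.log (x + y) := hL.trans_le hL'
  have hlow : D * Real.log x ≤ S := card_mul_log_le_theta_window hx0 hy
  have hupp : S ≤ D * Real.log (x + y) := theta_window_le_card_mul_log hx0 hy
  have hdiff : Real.log (x + y) - Real.log x ≤ y / x := by
    rw [← Real.log_div (by positivity) (by positivity)]
    calc Real.log ((x + y) / x) ≤ (x + y) / x - 1 := Real.log_le_sub_one_of_pos (by positivity)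
      _ = y / x := by field_simp; ring
  have habs : 0 ≤ |S - y| := abs_nonneg _
  rw [abs_le]
  constructor
  · -- `y/log x − D ≤ …`
    have h1 : S / Real.log (x + y) ≤ D := by rw [div_le_iff₀ hL'0]; exact hupp
    have h2 : y / Real.log x - S / Real.log (x + y)
        = (y - S) / Real.log (x + y)
          + y * (Real.log (x + y) - Real.log x) / (Real.log x * Real.log (x + y)) := by
      field_simp
      ring
    have h3 : (y - S) / Real.log (x + y) ≤ |S - y| / Real.log x := by
      calc (y - S) / Real.log (x + y) ≤ |S - y| / Real.log (x + y) := by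
            apply div_le_div_of_nonneg_right _ hL'0.le
            rw [abs_sub_comm]
            exact le_abs_self _
        _ ≤ |S - y| / Real.log x := div_le_div_of_nonneg_left habs hL hL'
    have h4 : y * (Real.log (x + y) - Real.log x) / (Real.log x * Real.log (x + y))
        ≤ y ^ 2 / (x * Real.log x ^ 2) := by
      calc y * (Real.log (x + y) - Real.log x) / (Real.log x * Real.log (x + y))
          ≤ y * (y / x) / (Real.log x * Real.log (x + y)) := by
            apply div_le_div_of_nonneg_right _ (mul_pos hL hL'0).le
            exact mul_le_mul_of_nonneg_left hdiff hy
        _ ≤ y * (y / x) / (Real.log x * Real.log x) :=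
            div_le_div_of_nonneg_left (by positivity) (mul_pos hL hL)
              (mul_le_mul_of_nonneg_left hL' hL.le)
        _ = y ^ 2 / (x * Real.log x ^ 2) := by
            field_simp
    linarith [h1, h2, h3, h4]
  · -- `D − y/log x ≤ (S − y)/log x ≤ …`
    have h1 : D ≤ S / Real.log x := by rw [le_div_iff₀ hL]; exact hlow
    have h3 : (S - y) / Real.log x ≤ |S - y| / Real.log x :=
      div_le_div_of_nonneg_right (le_abs_self _) hL.le
    have h4 : 0 ≤ y ^ 2 / (x * Real.log x ^ 2) := by positivity
    have h5 : S / Real.log x - y / Real.log x = (S - y) / Real.log x := by ring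
    linarith

/-! ### The proper prime powers in the window: `θ → ψ` -/

/-- `ψ − θ` is nondecreasing (it is the sum of `Λ` over the non-primes; cf.
`Halasz.psi_sub_theta_mono` in the tree). [cite: MontgomeryVaughan2007, Cor. 2.5 (ψ(x) − ϑ(x) = ∑_{k≥2} ϑ(x^{1/k}) ≪ x^{1/2})] -/
theorem psi_sub_theta_window_nonneg {x y : ℝ} (hy : 0 ≤ y) :
    0 ≤ (ψ (x + y) - θ (x + y)) - (ψ x - θ x) := by
  rw [Chebyshev.psi_sub_theta_eq_sum_not_prime, Chebyshev.psi_sub_theta_eq_sum_not_prime, sub_nonneg]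
  refine Finset.sum_le_sum_of_subset_of_nonneg ?_ fun n _ _ => ArithmeticFunction.vonMangoldt_nonneg
  exact Finset.filter_subset_filter _
    (Finset.Ioc_subset_Ioc_right (Nat.floor_le_floor (by linarith)))

/-- Crude bound for the proper prime powers in the window:
`(ψ−θ)(x+y) − (ψ−θ)(x) ≤ 2√(x+y) log(x+y)` for `x ≥ 1`, `y ≥ 0` (Mathlib:
`0 ≤ ψ − θ ≤ 2√x log x`; cf. `Halasz.psi_sub_psi_le` in the tree). [cite: MontgomeryVaughan2007, Cor. 2.5 (ψ(x) − ϑ(x) = ∑_{k≥2} ϑ(x^{1/k}) ≪ x^{1/2})] -/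
theorem psi_sub_theta_window_le_sqrt {x y : ℝ} (hx : 1 ≤ x) (hy : 0 ≤ y) :
    (ψ (x + y) - θ (x + y)) - (ψ x - θ x) ≤ 2 * Real.sqrt (x + y) * Real.log (x + y) := by
  have ha1 : ψ (x + y) - θ (x + y) ≤ 2 * Real.sqrt (x + y) * Real.log (x + y) :=
    Chebyshev.psi_sub_theta_le (by linarith)
  have hb0 : 0 ≤ ψ x - θ x := sub_nonneg.mpr (Chebyshev.theta_le_psi _)
  linarith

/-- `k`-th roots move little across a short window: for `x ≥ 1`, `y ≥ 0`, `k ≥ 2`,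
`(x+y)^{1/k} − x^{1/k} ≤ y/(2√x)` (Bernoulli: `(1 + y/x)^{1/k} ≤ 1 + (y/x)/k`, and
`x^{1/k}/x ≤ 1/√x`). Hence `(x, x+y]` contains at most `y/(2√x) + 1` `k`-th powers. [cite: MontgomeryVaughan2007, Cor. 2.5 (ψ(x) − ϑ(x) = ∑_{k≥2} ϑ(x^{1/k}) ≪ x^{1/2})] -/
theorem rpow_inv_window_le {x y : ℝ} (hx : 1 ≤ x) (hy : 0 ≤ y) {k : ℕ} (hk : 2 ≤ k) :
    (x + y) ^ ((1 : ℝ) / k) - x ^ ((1 : ℝ) / k) ≤ y / (2 * Real.sqrt x) := by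
  have hx0 : 0 < x := by linarith
  have hk0 : (0 : ℝ) < k := by exact_mod_cast (by omega : 0 < k)
  have hk2 : (2 : ℝ) ≤ k := by exact_mod_cast hk
  have hk1 : (1 : ℝ) / k ≤ 1 / 2 := by
    rw [div_le_div_iff₀ hk0 (by norm_num)]
    linarith
  have hk1' : 0 ≤ (1 : ℝ) / k := by positivity
  have hyx : 0 ≤ y / x := by positivity
  have e1 : (x + y) ^ ((1 : ℝ) / k) = x ^ ((1 : ℝ) / k) * (1 + y / x) ^ ((1 : ℝ) / k) := by
    rw [← Real.mul_rpow hx0.le (by positivity)]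
    congr 1
    field_simp
  have hb : (1 + y / x) ^ ((1 : ℝ) / k) ≤ 1 + (1 : ℝ) / k * (y / x) :=
    rpow_one_add_le_one_add_mul_self (by linarith) hk1' (hk1.trans (by norm_num))
  have hroot : x ^ ((1 : ℝ) / k) ≤ Real.sqrt x := by
    rw [Real.sqrt_eq_rpow]
    exact Real.rpow_le_rpow_of_exponent_le hx hk1
  have hsx : 0 < Real.sqrt x := Real.sqrt_pos.mpr hx0
  have hq : x ^ ((1 : ℝ) / k) / x ≤ 1 / Real.sqrt x := by
    rw [div_le_div_iff₀ hx0 hsx]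
    calc x ^ ((1 : ℝ) / k) * Real.sqrt x ≤ Real.sqrt x * Real.sqrt x :=
          mul_le_mul_of_nonneg_right hroot hsx.le
      _ = 1 * x := by rw [Real.mul_self_sqrt hx0.le, one_mul]
  have hr0 : 0 ≤ x ^ ((1 : ℝ) / k) := by positivity
  calc (x + y) ^ ((1 : ℝ) / k) - x ^ ((1 : ℝ) / k)
      = x ^ ((1 : ℝ) / k) * ((1 + y / x) ^ ((1 : ℝ) / k) - 1) := by rw [e1]; ring
    _ ≤ x ^ ((1 : ℝ) / k) * ((1 : ℝ) / k * (y / x)) :=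
        mul_le_mul_of_nonneg_left (by linarith) hr0
    _ = (1 : ℝ) / k * y * (x ^ ((1 : ℝ) / k) / x) := by ring
    _ ≤ 1 / 2 * y * (1 / Real.sqrt x) := by gcongr
    _ = y / (2 * Real.sqrt x) := by field_simp

/-- **Sharp bound for the proper prime powers in a short window**: for `x ≥ 2`, `y ≥ 0`,
`(ψ−θ)(x+y) − (ψ−θ)(x) ≤ (y/(2√x) + 1) log²(x+y)`.
Proof: `ψ − θ = ∑_{2 ≤ k ≤ log₂} θ(·^{1/k})` (Mathlib `Chebyshev.psi_eq_theta_add_sum_theta'`), each of the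
`≤ log(x+y)/log 2` differences `θ((x+y)^{1/k}) − θ(x^{1/k})` is `≤ ((x+y)^{1/k} − x^{1/k} + 1) log((x+y)^{1/k})
≤ (y/(2√x) + 1) log(x+y)/2`, and `2 log 2 > 1`. This is the form needed for windows with `y < √x`
(Guth–Maynard Cor. 1.4). [cite: MontgomeryVaughan2007, Cor. 2.5 (ψ(x) − ϑ(x) = ∑_{k≥2} ϑ(x^{1/k}) ≪ x^{1/2})] -/
theorem psi_sub_theta_window_le {x y : ℝ} (hx : 2 ≤ x) (hy : 0 ≤ y) :
    (ψ (x + y) - θ (x + y)) - (ψ x - θ x)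
      ≤ (y / (2 * Real.sqrt x) + 1) * Real.log (x + y) ^ 2 := by
  set N : ℕ := ⌊Real.log (x + y) / Real.log 2⌋₊ with hN
  have hx1 : 1 ≤ x := by linarith
  have hx0 : 0 < x := by linarith
  have hxy0 : 0 < x + y := by linarith
  have hlog2 : 0 < Real.log 2 := Real.log_pos (by norm_num)
  have hlogxy : 0 ≤ Real.log (x + y) := Real.log_nonneg (by linarith)
  have hNx : ⌊Real.log x / Real.log 2⌋₊ ≤ N := by
    apply Nat.floor_le_floor
    exact div_le_div_of_nonneg_right (Real.log_le_log hx0 (by linarith)) hlog2.le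
  have hB0 : 0 ≤ y / (2 * Real.sqrt x) + 1 := by positivity
  -- the term-wise bound
  have hterm : ∀ k ∈ Finset.Icc 2 N,
      θ ((x + y) ^ ((1 : ℝ) / k)) - θ (x ^ ((1 : ℝ) / k))
        ≤ (y / (2 * Real.sqrt x) + 1) * (Real.log (x + y) / 2) := by
    intro k hk
    rw [Finset.mem_Icc] at hk
    have hk2 : (2 : ℝ) ≤ k := by exact_mod_cast hk.1
    have hk0 : (0 : ℝ) < k := by linarith
    have ha1 : 1 ≤ x ^ ((1 : ℝ) / k) := Real.one_le_rpow hx1 (by positivity)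
    have hab : x ^ ((1 : ℝ) / k) ≤ (x + y) ^ ((1 : ℝ) / k) :=
      Real.rpow_le_rpow hx0.le (by linarith) (by positivity)
    -- write `(x+y)^{1/k} = x^{1/k} + d` with `0 ≤ d ≤ y/(2√x)`
    obtain ⟨d, hd0, hd⟩ : ∃ d : ℝ, 0 ≤ d ∧ (x + y) ^ ((1 : ℝ) / k) = x ^ ((1 : ℝ) / k) + d :=
      ⟨(x + y) ^ ((1 : ℝ) / k) - x ^ ((1 : ℝ) / k), sub_nonneg.mpr hab, by ring⟩
    have hdle : d ≤ y / (2 * Real.sqrt x) := by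
      have := rpow_inv_window_le hx1 hy hk.1
      linarith
    have hlogb : Real.log ((x + y) ^ ((1 : ℝ) / k)) = (1 : ℝ) / k * Real.log (x + y) :=
      Real.log_rpow hxy0 _
    have hlogb' : (1 : ℝ) / k * Real.log (x + y) ≤ Real.log (x + y) / 2 := by
      rw [div_mul_eq_mul_div, one_mul, div_le_div_iff₀ hk0 (by norm_num)]
      nlinarith
    calc θ ((x + y) ^ ((1 : ℝ) / k)) - θ (x ^ ((1 : ℝ) / k))
        = θ (x ^ ((1 : ℝ) / k) + d) - θ (x ^ ((1 : ℝ) / k)) := by rw [hd]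
      _ ≤ (d + 1) * Real.log (x ^ ((1 : ℝ) / k) + d) := theta_window_le ha1 hd0
      _ = (d + 1) * ((1 : ℝ) / k * Real.log (x + y)) := by rw [← hd, hlogb]
      _ ≤ (y / (2 * Real.sqrt x) + 1) * (Real.log (x + y) / 2) := by
          apply mul_le_mul (by linarith) hlogb' (by positivity) hB0
  rw [Chebyshev.psi_eq_theta_add_sum_theta' (by linarith) le_rfl,
    Chebyshev.psi_eq_theta_add_sum_theta' hx hNx]
  have e : θ (x + y) + ∑ k ∈ Finset.Icc 2 N, θ ((x + y) ^ ((1 : ℝ) / k)) - θ (x + y)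
      - (θ x + ∑ k ∈ Finset.Icc 2 N, θ (x ^ ((1 : ℝ) / k)) - θ x)
      = ∑ k ∈ Finset.Icc 2 N, (θ ((x + y) ^ ((1 : ℝ) / k)) - θ (x ^ ((1 : ℝ) / k))) := by
    rw [Finset.sum_sub_distrib]
    ring
  rw [e]
  have hcard : ((Finset.Icc 2 N).card : ℝ) ≤ Real.log (x + y) / Real.log 2 := by
    rw [Nat.card_Icc]
    calc ((N + 1 - 2 : ℕ) : ℝ) ≤ N := by exact_mod_cast (by omega : N + 1 - 2 ≤ N)
      _ ≤ Real.log (x + y) / Real.log 2 := Nat.floor_le (by positivity)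
  calc ∑ k ∈ Finset.Icc 2 N, (θ ((x + y) ^ ((1 : ℝ) / k)) - θ (x ^ ((1 : ℝ) / k)))
      ≤ ∑ k ∈ Finset.Icc 2 N, (y / (2 * Real.sqrt x) + 1) * (Real.log (x + y) / 2) :=
        Finset.sum_le_sum hterm
    _ = ((Finset.Icc 2 N).card : ℝ) * ((y / (2 * Real.sqrt x) + 1) * (Real.log (x + y) / 2)) := by
        rw [Finset.sum_const, nsmul_eq_mul]
    _ ≤ Real.log (x + y) / Real.log 2 * ((y / (2 * Real.sqrt x) + 1) * (Real.log (x + y) / 2)) :=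
        mul_le_mul_of_nonneg_right hcard (by positivity)
    _ = (y / (2 * Real.sqrt x) + 1) * Real.log (x + y) ^ 2 * (1 / (2 * Real.log 2)) := by
        field_simp
    _ ≤ (y / (2 * Real.sqrt x) + 1) * Real.log (x + y) ^ 2 * 1 := by
        apply mul_le_mul_of_nonneg_left _ (by positivity)
        rw [div_le_one (by positivity)]
        linarith [Real.log_two_gt_d9]
    _ = (y / (2 * Real.sqrt x) + 1) * Real.log (x + y) ^ 2 := mul_one _

/-- Removing the prime powers (crude): `|θ(x+y) − θ(x) − y| ≤ |ψ(x+y) − ψ(x) − y| + 2√(x+y) log(x+y)`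
for `x ≥ 1`, `y ≥ 0`. [cite: MontgomeryVaughan2007, Cor. 2.5 (ψ(x) − ϑ(x) = ∑_{k≥2} ϑ(x^{1/k}) ≪ x^{1/2})] -/
theorem abs_theta_window_sub_le {x y : ℝ} (hx : 1 ≤ x) (hy : 0 ≤ y) :
    |θ (x + y) - θ x - y|
      ≤ |ψ (x + y) - ψ x - y| + 2 * Real.sqrt (x + y) * Real.log (x + y) := by
  have h0 := psi_sub_theta_window_nonneg (x := x) hy
  have h1 := psi_sub_theta_window_le_sqrt hx hy
  have e : θ (x + y) - θ x - y
      = (ψ (x + y) - ψ x - y) - ((ψ (x + y) - θ (x + y)) - (ψ x - θ x)) := by ring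
  rw [e, abs_le]
  constructor
  · linarith [neg_abs_le (ψ (x + y) - ψ x - y)]
  · linarith [le_abs_self (ψ (x + y) - ψ x - y)]

/-- Removing the prime powers (sharp): `|θ(x+y) − θ(x) − y| ≤ |ψ(x+y) − ψ(x) − y| + (y/(2√x) + 1) log²(x+y)`
for `x ≥ 2`, `y ≥ 0`. [cite: MontgomeryVaughan2007, Cor. 2.5 (ψ(x) − ϑ(x) = ∑_{k≥2} ϑ(x^{1/k}) ≪ x^{1/2})] -/
theorem abs_theta_window_sub_le_sharp {x y : ℝ} (hx : 2 ≤ x) (hy : 0 ≤ y) :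
    |θ (x + y) - θ x - y|
      ≤ |ψ (x + y) - ψ x - y| + (y / (2 * Real.sqrt x) + 1) * Real.log (x + y) ^ 2 := by
  have h0 := psi_sub_theta_window_nonneg (x := x) hy
  have h1 := psi_sub_theta_window_le hx hy
  have e : θ (x + y) - θ x - y
      = (ψ (x + y) - ψ x - y) - ((ψ (x + y) - θ (x + y)) - (ψ x - θ x)) := by ring
  rw [e, abs_le]
  constructor
  · linarith [neg_abs_le (ψ (x + y) - ψ x - y)]
  · linarith [le_abs_self (ψ (x + y) - ψ x - y)]

/-! ### The transfer `ψ → π` -/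

/-- **`ψ → π` in a short window (crude prime-power term)**: for `x > 1`, `y ≥ 0`,
`|π(x+y) − π(x) − y/log x| ≤ (|ψ(x+y) − ψ(x) − y| + 2√(x+y) log(x+y))/log x + y²/(x log² x)`.
[cite: GuthMaynard2026, §13.2 (proof of Cor. 1.3)] -/
theorem abs_primeCounting_window_sub_le_of_psi {x y : ℝ} (hx : 1 < x) (hy : 0 ≤ y) :
    |(π ⌊x + y⌋₊ : ℝ) - π ⌊x⌋₊ - y / Real.log x|
      ≤ (|ψ (x + y) - ψ x - y| + 2 * Real.sqrt (x + y) * Real.log (x + y)) / Real.log x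
        + y ^ 2 / (x * Real.log x ^ 2) := by
  have hL : 0 < Real.log x := Real.log_pos hx
  calc |(π ⌊x + y⌋₊ : ℝ) - π ⌊x⌋₊ - y / Real.log x|
      ≤ |θ (x + y) - θ x - y| / Real.log x + y ^ 2 / (x * Real.log x ^ 2) :=
        abs_primeCounting_window_sub_le hx hy
    _ ≤ _ := by
        gcongr
        exact abs_theta_window_sub_le hx.le hy

/-- **`ψ → π` in a short window (sharp prime-power term)**: for `x ≥ 2`, `y ≥ 0`,
`|π(x+y) − π(x) − y/log x| ≤ (|ψ(x+y) − ψ(x) − y| + (y/(2√x) + 1) log²(x+y))/log x + y²/(x log² x)`.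
[cite: GuthMaynard2026, §13.2 (proof of Cor. 1.4)] -/
theorem abs_primeCounting_window_sub_le_of_psi_sharp {x y : ℝ} (hx : 2 ≤ x) (hy : 0 ≤ y) :
    |(π ⌊x + y⌋₊ : ℝ) - π ⌊x⌋₊ - y / Real.log x|
      ≤ (|ψ (x + y) - ψ x - y| + (y / (2 * Real.sqrt x) + 1) * Real.log (x + y) ^ 2) / Real.log x
        + y ^ 2 / (x * Real.log x ^ 2) := by
  have hx1 : 1 < x := by linarith
  have hL : 0 < Real.log x := Real.log_pos hx1
  calc |(π ⌊x + y⌋₊ : ℝ) - π ⌊x⌋₊ - y / Real.log x|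
      ≤ |θ (x + y) - θ x - y| / Real.log x + y ^ 2 / (x * Real.log x ^ 2) :=
        abs_primeCounting_window_sub_le hx1 hy
    _ ≤ _ := by
        gcongr
        exact abs_theta_window_sub_le_sharp hx hy

/-- `E`-form (crude): if `|ψ(x+y) − ψ(x) − y| ≤ E` then
`|π(x+y) − π(x) − y/log x| ≤ E/log x + 2√(x+y) log(x+y)/log x + y²/(x log² x)` (`x > 1`, `y ≥ 0`).
[cite: GuthMaynard2026, §13.2 (proof of Cor. 1.3)] -/
theorem abs_primeCounting_window_sub_le_of_abs_psi_le {x y E : ℝ} (hx : 1 < x) (hy : 0 ≤ y)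
    (hE : |ψ (x + y) - ψ x - y| ≤ E) :
    |(π ⌊x + y⌋₊ : ℝ) - π ⌊x⌋₊ - y / Real.log x|
      ≤ E / Real.log x + 2 * Real.sqrt (x + y) * Real.log (x + y) / Real.log x
        + y ^ 2 / (x * Real.log x ^ 2) := by
  have hL : 0 < Real.log x := Real.log_pos hx
  have h := abs_primeCounting_window_sub_le_of_psi hx hy
  rw [add_div] at h
  have h2 : |ψ (x + y) - ψ x - y| / Real.log x ≤ E / Real.log x :=
    div_le_div_of_nonneg_right hE hL.le
  linarith

/-- `E`-form (sharp): if `|ψ(x+y) − ψ(x) − y| ≤ E` then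
`|π(x+y) − π(x) − y/log x| ≤ E/log x + (y/(2√x) + 1) log²(x+y)/log x + y²/(x log² x)`
(`x ≥ 2`, `y ≥ 0`). [cite: GuthMaynard2026, §13.2 (proof of Cor. 1.4)] -/
theorem abs_primeCounting_window_sub_le_of_abs_psi_le_sharp {x y E : ℝ} (hx : 2 ≤ x) (hy : 0 ≤ y)
    (hE : |ψ (x + y) - ψ x - y| ≤ E) :
    |(π ⌊x + y⌋₊ : ℝ) - π ⌊x⌋₊ - y / Real.log x|
      ≤ E / Real.log x + (y / (2 * Real.sqrt x) + 1) * Real.log (x + y) ^ 2 / Real.log x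
        + y ^ 2 / (x * Real.log x ^ 2) := by
  have hL : 0 < Real.log x := Real.log_pos (by linarith)
  have h := abs_primeCounting_window_sub_le_of_psi_sharp hx hy
  rw [add_div] at h
  have h2 : |ψ (x + y) - ψ x - y| / Real.log x ≤ E / Real.log x :=
    div_le_div_of_nonneg_right hE hL.le
  linarith

/-! ### Growth bookkeeping for error terms `exp(−(log x)^κ)`, `κ < 1` -/

/-- For `a > 0` and `κ < 1` there is `U` with `u^κ ≤ a u` for all `u ≥ U`
(`U = max 1 (a⁻¹)^{1/(1−κ)}`). [cite: GuthMaynard2026, §13.2 (x^{−ε} ≪_ε exp(−(log x)^{1/4}), the growth step of the proof of Cor. 1.3)] -/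
theorem exists_rpow_le_mul {a κ : ℝ} (ha : 0 < a) (hκ : κ < 1) :
    ∃ U : ℝ, ∀ u : ℝ, U ≤ u → u ^ κ ≤ a * u := by
  refine ⟨max 1 (a⁻¹ ^ (1 / (1 - κ))), fun u hu => ?_⟩
  have hu1 : 1 ≤ u := (le_max_left _ _).trans hu
  have hu0 : 0 < u := by linarith
  have hua : a⁻¹ ^ (1 / (1 - κ)) ≤ u := (le_max_right _ _).trans hu
  have h1κ : 0 < 1 - κ := by linarith
  -- `u^{1−κ} ≥ (a⁻¹^{1/(1−κ)})^{1−κ} = a⁻¹`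
  have hpow : a⁻¹ ≤ u ^ (1 - κ) := by
    have h := Real.rpow_le_rpow (by positivity) hua h1κ.le
    rwa [← Real.rpow_mul (by positivity), show 1 / (1 - κ) * (1 - κ) = 1 by field_simp,
      Real.rpow_one] at h
  have hsplit : u = u ^ κ * u ^ (1 - κ) := by
    rw [← Real.rpow_add hu0, show κ + (1 - κ) = 1 by ring, Real.rpow_one]
  have hq0 : 0 ≤ u ^ κ := by positivity
  calc u ^ κ = u ^ κ * a⁻¹ * a := by field_simp
    _ ≤ u ^ κ * u ^ (1 - κ) * a := by gcongr
    _ = a * u := by rw [← hsplit]; ring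

/-- Consequence: for `a > 0`, `κ < 1` and `x ≥ x₁(a, κ)`, `exp((log x)^κ) ≤ x^a`; equivalently
`x^{−a} ≤ exp(−(log x)^κ)`. [cite: GuthMaynard2026, §13.2 (x^{−ε} ≪_ε exp(−(log x)^{1/4}), the growth step of the proof of Cor. 1.3)] -/
theorem exists_exp_log_rpow_le_rpow {a κ : ℝ} (ha : 0 < a) (hκ : κ < 1) :
    ∃ x₁ : ℝ, ∀ x : ℝ, x₁ ≤ x → Real.exp (Real.log x ^ κ) ≤ x ^ a := by
  obtain ⟨U, hU⟩ := exists_rpow_le_mul ha hκ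
  refine ⟨max 1 (Real.exp U), fun x hx => ?_⟩
  have hx1 : 1 ≤ x := (le_max_left _ _).trans hx
  have hx0 : 0 < x := by linarith
  have hU' : U ≤ Real.log x := by
    rw [Real.le_log_iff_exp_le hx0]
    exact (le_max_right _ _).trans hx
  rw [Real.rpow_def_of_pos hx0]
  exact Real.exp_le_exp.mpr (by linarith [hU _ hU'])

end PrimeWindow

end Literature.NumberTheory.LFunctions
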